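import Mathlib.RingTheory.MvPolynomial.WeightedHomogeneous
import Mathlib.RingTheory.MvPolynomial.Homogeneous
import Literature.Computability.AlgebraicComplexity.SymbolicMatrixMinors
import HarnessLib

/-!
# Symbolic matrices: weighted-homogeneous low-rank decompositions
(Efremenko–Garg–Oliveira–Wigderson 2018, Lemma 3.2 second half, Lemmas 3.3 and 3.5)

Topic: `Literature/Computability/AlgebraicComplexity`. Second part of the proof of the rank-method
barriers (`RankMethodBarriers.lean`), continuing `SymbolicMatrixMinors.lean`.

We work with a *weight* `w : σ → W` on the variables (values in an additive commutative monoid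
`W`) together with an additive `φ : W →+ ℕ` with `φ (w v) = 1` for every variable, so that
`φ (weight s) = degree s` for every monomial `s`. The two instances used by the paper are

* `W = ℕ`, `w = 1` (total degree; homogeneous components `H_t`, Def. 2.1) — Waring rank;
* `W = (Fin d → ℕ)`, `w (j, i) = e_j` (multidegree with respect to the partition
  `x = (x_1, …, x_d)`; set-multilinear components `H^{SM}_S`, Def. 2.2) — tensor rank.

Main results:

* `weightedHomogeneousComponent_mul_eq_sum` — the component of weight `ω` of a product is
  `∑_{(ω₁, ω₂) ∈ T} H_{ω₁}[p] · H_{ω₂}[q]` for any finite set `T` of splittings `ω₁ + ω₂ = ω`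
  containing all splittings by monomial weights (the identity behind "decomposing into homogeneous
  [set-multilinear] components", proofs of Lemma 3.3 and Lemma 3.5).
* `weightedHomogeneousComponent_translate` — `H_ω[p(x + a)] = p(x)` for `p` weighted-homogeneous
  of weight `ω` ("from homogeneity of `M(x)`, we have `M(x) = H_d[M(x + a)]`", proof of Lemma 3.2).
* `weightedHomogeneousComponent_pow_mul_eq_zero` — `H_ν[ε^{D+1} q] = 0` when `ε(0) = 0` and
  `φ ν ≤ D` (the truncation `H_{≤ d}` in the proof of Lemma 3.2).
* `exists_weighted_decomposition` — **Lemmas 3.3 / 3.5 (with Lemma 3.2)**: a matrix `P` of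
  weighted-homogeneous polynomials of weight `ω` over an infinite field factors as
  `P = ∑_{(ω₁, ω₂) ∈ T} K_{ω₁} · M_{ω₂}` with `ρ ≤ rank P(a)` columns in each `K_{ω₁}`, the entries
  of `K_ν`, `M_ν` weighted-homogeneous of weight `ν` (homogeneous rank `≤ ρ (d+1)`, resp.
  set-multilinear rank `≤ ρ 2^d`, once `T` is the set of `d + 1`, resp. `2^d`, splittings).

## References

* [EfremenkoGargOliveiraWigderson2018] K. Efremenko, A. Garg, R. Oliveira, A. Wigderson,
  *Barriers for rank methods in arithmetic complexity*, ITCS 2018; arXiv:1710.09502, Def. 2.1,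
  Def. 2.2, §3 (Lemma 3.2, Lemma 3.3, Def. 3.4, Lemma 3.5).
-/

noncomputable section

open MvPolynomial

namespace Literature.Computability.AlgebraicComplexity

/-! ## Weighted components of products -/

section Components

variable {R : Type*} [CommSemiring R] {σ : Type*} [DecidableEq σ] {W : Type*} [AddCommMonoid W]
  [DecidableEq W]

/-- **Components of a product.** If `T` is a finite set of splittings `ω₁ + ω₂ = ω` containing
`(weight s, weight t)` for all monomials `s` of `p`, `t` of `q` with `weight s + weight t = ω`, then
`H_ω[p q] = ∑_{(ω₁,ω₂) ∈ T} H_{ω₁}[p] H_{ω₂}[q]` (EGOW 2018, proofs of Lemma 3.3 — `T` the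
`d + 1` splittings `k + (d-k)` — and Lemma 3.5 — `T` the `2^d` splittings `S ⊔ ([d] ∖ S)`).
[cite: EfremenkoGargOliveiraWigderson2018, Lemma 3.3 and Lemma 3.5] -/
theorem weightedHomogeneousComponent_mul_eq_sum (w : σ → W) (p q : MvPolynomial σ R) (ω : W)
    (T : Finset (W × W)) (hT : ∀ x ∈ T, x.1 + x.2 = ω)
    (hT' : ∀ s t : σ →₀ ℕ, coeff s p ≠ 0 → coeff t q ≠ 0 →
      Finsupp.weight w s + Finsupp.weight w t = ω → (Finsupp.weight w s, Finsupp.weight w t) ∈ T) :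
    weightedHomogeneousComponent w ω (p * q) =
      ∑ x ∈ T, weightedHomogeneousComponent w x.1 p * weightedHomogeneousComponent w x.2 q := by
  ext d
  rw [coeff_weightedHomogeneousComponent, coeff_sum]
  simp_rw [coeff_mul, coeff_weightedHomogeneousComponent]
  rw [Finset.sum_comm]
  split_ifs with hd
  · refine Finset.sum_congr rfl fun x hx => ?_
    rw [Finset.mem_antidiagonal] at hx
    rw [Finset.sum_eq_single (Finsupp.weight w x.1, Finsupp.weight w x.2)]
    · simp
    · intro y _ hne
      by_cases h1 : Finsupp.weight w x.1 = y.1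
      · have h2 : Finsupp.weight w x.2 ≠ y.2 := by
          intro h2
          exact hne (Prod.ext h1 h2).symm
        rw [if_neg h2, mul_zero]
      · rw [if_neg h1, zero_mul]
    · intro hnot
      rw [if_pos rfl, if_pos rfl]
      by_contra hne0
      exact hnot (hT' _ _ (left_ne_zero_of_mul hne0) (right_ne_zero_of_mul hne0)
        (by rw [← map_add, hx, hd]))
  · symm
    refine Finset.sum_eq_zero fun x hx => Finset.sum_eq_zero fun y hy => ?_
    rw [Finset.mem_antidiagonal] at hx
    split_ifs with h1 h2
    · exfalso
      apply hd
      rw [← hx, map_add, h1, h2]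
      exact hT y hy
    all_goals simp

/-- If `f` has no monomials of degree `< N_f` and `g` none of degree `< N_g`, then `f g` has none
of degree `< N_f + N_g`. [folklore] -/
theorem coeff_mul_eq_zero_of_degree_lt {f g : MvPolynomial σ R} {Nf Ng : ℕ}
    (hf : ∀ d : σ →₀ ℕ, Finsupp.degree d < Nf → coeff d f = 0)
    (hg : ∀ d : σ →₀ ℕ, Finsupp.degree d < Ng → coeff d g = 0)
    (d : σ →₀ ℕ) (hd : Finsupp.degree d < Nf + Ng) : coeff d (f * g) = 0 := by
  rw [coeff_mul]
  refine Finset.sum_eq_zero fun x hx => ?_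
  rw [Finset.mem_antidiagonal] at hx
  by_cases h1 : Finsupp.degree x.1 < Nf
  · rw [hf _ h1, zero_mul]
  · have h2 : Finsupp.degree x.2 < Ng := by
      have h := congrArg Finsupp.degree hx
      rw [map_add] at h
      omega
    rw [hg _ h2, mul_zero]

/-- A polynomial without constant term raised to the `N`-th power has no monomials of degree
`< N`. [folklore] -/
theorem coeff_pow_eq_zero_of_degree_lt {ε : MvPolynomial σ R} (hε : constantCoeff ε = 0) :
    ∀ (N : ℕ) (d : σ →₀ ℕ), Finsupp.degree d < N → coeff d (ε ^ N) = 0 := by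
  intro N
  induction N with
  | zero => intro d hd; omega
  | succ N ih =>
    intro d hd
    rw [pow_succ]
    refine coeff_mul_eq_zero_of_degree_lt ih (fun d' hd' => ?_) d hd
    have h0 : d' = 0 := by
      have h : Finsupp.degree d' = 0 := by omega
      exact (Finsupp.degree_eq_zero_iff d').mp h
    rw [h0]
    exact hε

omit [DecidableEq σ] [DecidableEq W] in
/-- With `φ (w v) = 1` for all variables, `φ (weight s) = degree s`. [folklore] -/
theorem map_weight_eq_degree (w : σ → W) (φ : W →+ ℕ) (hφ : ∀ v, φ (w v) = 1) (d : σ →₀ ℕ) :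
    φ (Finsupp.weight w d) = Finsupp.degree d := by
  rw [Finsupp.weight_apply, map_finsuppSum, Finsupp.degree_apply]
  simp only [map_nsmul, hφ, smul_eq_mul, mul_one]
  rfl

/-- **Truncation**: `H_ν[ε^{D+1} · q] = 0` whenever `ε` has no constant term and `φ ν ≤ D`
(all monomials of `ε^{D+1} q` have degree `> D`; this is the step
`H_{≤ d}[… ∑_{j ≥ 0} ε^j] = H_{≤ d}[… ∑_{j ≤ d} ε^j]` in the proof of Lemma 3.2).
[cite: EfremenkoGargOliveiraWigderson2018, Lemma 3.2] -/
theorem weightedHomogeneousComponent_pow_mul_eq_zero (w : σ → W) (φ : W →+ ℕ)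
    (hφ : ∀ v, φ (w v) = 1) {ε : MvPolynomial σ R} (hε : constantCoeff ε = 0)
    (q : MvPolynomial σ R) {ν : W} {D : ℕ} (hν : φ ν ≤ D) :
    weightedHomogeneousComponent w ν (ε ^ (D + 1) * q) = 0 := by
  ext d
  rw [coeff_weightedHomogeneousComponent, coeff_zero]
  split_ifs with hd
  · refine coeff_mul_eq_zero_of_degree_lt (Ng := 0) (coeff_pow_eq_zero_of_degree_lt hε (D + 1))
      (fun _ h => absurd h (Nat.not_lt_zero _)) d ?_
    rw [← map_weight_eq_degree w φ hφ d, hd]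
    omega
  · rfl

omit [DecidableEq σ] in
/-- For the weight `1` (every variable has weight one) the weight of a monomial is its degree.
[folklore] -/
theorem weight_one_eq_degree (s : σ →₀ ℕ) : Finsupp.weight (1 : σ → ℕ) s = Finsupp.degree s := by
  rw [Finsupp.degree_eq_weight_one]
  rfl

/-- **Top homogeneous components multiply**: if `deg p ≤ m` and `deg q ≤ n` then
`H_{m+n}[p q] = H_m[p] · H_n[q]`. [folklore] -/
theorem homogeneousComponent_mul_of_totalDegree_le (p q : MvPolynomial σ R) {m n : ℕ}
    (hp : p.totalDegree ≤ m) (hq : q.totalDegree ≤ n) :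
    homogeneousComponent (m + n) (p * q) = homogeneousComponent m p * homogeneousComponent n q := by
  have h := weightedHomogeneousComponent_mul_eq_sum (1 : σ → ℕ) p q (m + n) {(m, n)} (by simp) ?_
  · show weightedHomogeneousComponent 1 (m + n) (p * q) =
      weightedHomogeneousComponent 1 m p * weightedHomogeneousComponent 1 n q
    rw [h, Finset.sum_singleton]
  · intro s t hs ht hst
    rw [weight_one_eq_degree, weight_one_eq_degree] at hst ⊢
    have hs' : Finsupp.degree s ≤ m := (le_totalDegree (mem_support_iff.mpr hs)).trans hp
    have ht' : Finsupp.degree t ≤ n := (le_totalDegree (mem_support_iff.mpr ht)).trans hq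
    simp only [Finset.mem_singleton, Prod.mk.injEq]
    change Finsupp.degree s ≤ m at hs'
    change Finsupp.degree t ≤ n at ht'
    omega

end Components

/-! ## Translation preserves the top component -/

section TranslateTop

variable {F : Type*} [Field F] {σ : Type*} [DecidableEq σ]

omit [DecidableEq σ] in
/-- `deg p(x + a) ≤ deg p` for a monomial `p`. [folklore] -/
theorem totalDegree_translate_monomial_le (a : σ → F) (s : σ →₀ ℕ) (c : F) :
    (eval₂Hom C (fun v => X v + C (a v)) (monomial s c)).totalDegree ≤ Finsupp.degree s := by
  rw [eval₂Hom_monomial]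
  refine (totalDegree_mul _ _).trans ?_
  rw [totalDegree_C, zero_add]
  unfold Finsupp.prod
  refine (totalDegree_finsetProd _ _).trans ?_
  rw [Finsupp.degree_apply]
  refine Finset.sum_le_sum fun i _ => (totalDegree_pow _ _).trans ?_
  have h1 : (X i + C (a i) : MvPolynomial σ F).totalDegree ≤ 1 :=
    (totalDegree_add _ _).trans (max_le (totalDegree_X (R := F) i).le (by simp))
  calc s i * (X i + C (a i)).totalDegree ≤ s i * 1 := Nat.mul_le_mul_left _ h1
    _ = s i := mul_one _

/-- `H_e[(X_v + c)^e] = X_v^e`. [folklore] -/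
theorem homogeneousComponent_X_add_C_pow (v : σ) (c : F) (e : ℕ) :
    homogeneousComponent e ((X v + C c : MvPolynomial σ F) ^ e) = X v ^ e := by
  have hXC : (X v + C c : MvPolynomial σ F).totalDegree ≤ 1 :=
    (totalDegree_add _ _).trans (max_le (totalDegree_X (R := F) v).le (by simp))
  induction e with
  | zero => simp [homogeneousComponent_zero]
  | succ e ih =>
    have hpow : ((X v + C c : MvPolynomial σ F) ^ e).totalDegree ≤ e := by
      refine (totalDegree_pow _ _).trans ?_
      calc e * (X v + C c).totalDegree ≤ e * 1 := Nat.mul_le_mul_left _ hXC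
        _ = e := mul_one _
    rw [pow_succ, homogeneousComponent_mul_of_totalDegree_le _ _ hpow hXC, ih, pow_succ, map_add,
      homogeneousComponent_of_mem ((mem_homogeneousSubmodule 1 _).mpr (isHomogeneous_X F v)),
      homogeneousComponent_of_mem ((mem_homogeneousSubmodule 0 _).mpr (isHomogeneous_C σ c))]
    simp

/-- **The top homogeneous component of a translated monomial is the monomial**:
`H_{|s|}[c · (x + a)^s] = c · x^s`. [folklore] -/
theorem homogeneousComponent_translate_monomial (a : σ → F) (s : σ →₀ ℕ) (c : F) :
    homogeneousComponent (Finsupp.degree s) (eval₂Hom C (fun v => X v + C (a v)) (monomial s c)) =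
      monomial s c := by
  induction s using Finsupp.induction with
  | zero =>
    simp only [map_zero, eval₂Hom_monomial, Finsupp.prod_zero_index, mul_one, homogeneousComponent_zero,
      coeff_C, if_true]
    rfl
  | single_add v e s hv he ih =>
    rw [monomial_single_add, map_mul, map_pow, eval₂Hom_X', map_add, Finsupp.degree_single, add_comm e,
      add_comm] -- degree: e + degree s ; reorder to (degree s ... )
    rw [homogeneousComponent_mul_of_totalDegree_le _ _ ?_ (totalDegree_translate_monomial_le a s c),
      homogeneousComponent_X_add_C_pow, ih]
    refine (totalDegree_pow _ _).trans ?_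
    have h1 : (X v + C (a v) : MvPolynomial σ F).totalDegree ≤ 1 :=
      (totalDegree_add _ _).trans (max_le (totalDegree_X (R := F) v).le (by simp))
    calc e * (X v + C (a v)).totalDegree ≤ e * 1 := Nat.mul_le_mul_left _ h1
      _ = e := mul_one _

variable {W : Type*} [AddCommMonoid W] [DecidableEq W]

/-- **Translation and the top weighted component** (EGOW 2018, proof of Lemma 3.2: "from
homogeneity of `M(x)`, we have `M(x) = H_d[M(x + a)]`", and its set-multilinear analogue used
in Lemma 3.5): if `p` is weighted-homogeneous of weight `ω` for a weight with `φ ∘ w = 1`, then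
`H_ω[p(x + a)] = p(x)`. [cite: EfremenkoGargOliveiraWigderson2018, Lemma 3.2] -/
theorem weightedHomogeneousComponent_translate (w : σ → W) (φ : W →+ ℕ) (hφ : ∀ v, φ (w v) = 1)
    (a : σ → F) {p : MvPolynomial σ F} {ω : W} (hp : IsWeightedHomogeneous w p ω) :
    weightedHomogeneousComponent w ω (eval₂Hom C (fun v => X v + C (a v)) p) = p := by
  have key : ∀ s ∈ p.support, weightedHomogeneousComponent w ω
      (eval₂Hom C (fun v => X v + C (a v)) (monomial s (coeff s p))) = monomial s (coeff s p) := by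
    intro s hs
    have hws : Finsupp.weight w s = ω := hp (mem_support_iff.mp hs)
    ext d
    rw [coeff_weightedHomogeneousComponent]
    split_ifs with hd
    · have hdeg : Finsupp.degree d = Finsupp.degree s := by
        rw [← map_weight_eq_degree w φ hφ d, ← map_weight_eq_degree w φ hφ s, hd, hws]
      have h := congrArg (coeff d) (homogeneousComponent_translate_monomial a s (coeff s p))
      rwa [coeff_homogeneousComponent, if_pos hdeg] at h
    · rw [coeff_monomial, if_neg]
      rintro rfl
      exact hd hws
  conv_lhs => rw [p.as_sum, map_sum, map_sum]
  rw [Finset.sum_congr rfl key]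
  exact p.as_sum.symm

end TranslateTop

/-! ## The weighted decomposition theorem (Lemmas 3.3 and 3.5) -/

section Decomposition

variable {F : Type*} [Field F] [Infinite F] {σ : Type*} [DecidableEq σ] {W : Type*} [AddCommMonoid W]
  [DecidableEq W] {ι : Type*} [Fintype ι]

/-- **Weighted low-rank decomposition with polynomial entries** (EGOW 2018, Lemma 3.2 with
Lemma 3.3 — homogeneous rank `≤ r (d+1)` — and Lemma 3.5 — set-multilinear rank `≤ r 2^d`, in
one weighted statement). Let `w` be a weight with `φ ∘ w = 1`, `T` a finite set of splittings
`ω₁ + ω₂ = ω` containing every splitting of `ω` into two monomial weights, and `P` a square matrix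
of weighted-homogeneous polynomials of weight `ω` over an infinite field `F`. Then there are
`ρ`, a point `a` with `ρ ≤ rank P(a)`, and polynomial matrices `K_ν` (`ρ` columns) and `M_ν`
(`ρ` rows) with entries weighted-homogeneous of weight `ν`, such that
`P = ∑_{(ω₁, ω₂) ∈ T} K_{ω₁} · M_{ω₂}`. [cite: EfremenkoGargOliveiraWigderson2018, Lemma 3.3 and Lemma 3.5] -/
theorem exists_weighted_decomposition (w : σ → W) (φ : W →+ ℕ) (hφ : ∀ v, φ (w v) = 1)
    (ω : W) (T : Finset (W × W)) (hT : ∀ x ∈ T, x.1 + x.2 = ω)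
    (hT' : ∀ s t : σ →₀ ℕ, Finsupp.weight w s + Finsupp.weight w t = ω →
      (Finsupp.weight w s, Finsupp.weight w t) ∈ T)
    (P : Matrix ι ι (MvPolynomial σ F)) (hP : ∀ i j, IsWeightedHomogeneous w (P i j) ω) :
    ∃ (ρ : ℕ) (a : σ → F) (K : W → Matrix ι (Fin ρ) (MvPolynomial σ F))
      (M : W → Matrix (Fin ρ) ι (MvPolynomial σ F)),
      ρ ≤ (P.map (eval a)).rank ∧
      (∀ ν i k, IsWeightedHomogeneous w (K ν i k) ν) ∧
      (∀ ν k j, IsWeightedHomogeneous w (M ν k j) ν) ∧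
      P = ∑ x ∈ T, K x.1 * M x.2 := by
  obtain ⟨ρ, a, cI, B', ε, hρ, hε, hdec⟩ := exists_translate_decomposition P (φ ω)
  have htr : ∀ i j, (P.map (eval₂Hom C fun v => X v + C (a v))) i j =
      eval₂Hom C (fun v => X v + C (a v)) (P i j) := fun i j => rfl
  generalize hP' : P.map (eval₂Hom C fun v => X v + C (a v)) = P' at hdec htr
  refine ⟨ρ, a, fun ν => (P'.submatrix id cI).map (weightedHomogeneousComponent w ν),
    fun ν => B'.map (weightedHomogeneousComponent w ν), hρ,
    fun ν i k => weightedHomogeneousComponent_isWeightedHomogeneous ν _,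
    fun ν k j => weightedHomogeneousComponent_isWeightedHomogeneous ν _, ?_⟩
  refine Matrix.ext fun i j => ?_
  have h1 : P i j = weightedHomogeneousComponent w ω (P' i j) := by
    rw [htr, weightedHomogeneousComponent_translate w φ hφ a (hP i j)]
  have hij : P' i j = (P'.submatrix id cI * B') i j + ε ^ (φ ω + 1) * P' i j := by
    conv_lhs => rw [hdec]
    simp [Matrix.add_apply, Matrix.smul_apply, smul_eq_mul]
  rw [h1, hij, map_add, weightedHomogeneousComponent_pow_mul_eq_zero w φ hφ hε _ le_rfl, add_zero,
    Matrix.mul_apply, map_sum, Matrix.sum_apply]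
  simp_rw [Matrix.mul_apply, Matrix.map_apply, Matrix.submatrix_apply, id]
  rw [Finset.sum_comm]
  refine Finset.sum_congr rfl fun k _ => ?_
  exact weightedHomogeneousComponent_mul_eq_sum w _ _ ω T hT (fun s t _ _ h => hT' s t h)

end Decomposition

end Literature.Computability.AlgebraicComplexity
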